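import Summits.Ventures.CertifiedManyBodySolver.Theorems.R2cFamilyBelowLineClosures
import Literature.MathematicalPhysics.QuantumLattice.TorusSectorPressureTypeBoundAllTori
import Literature.MathematicalPhysics.QuantumLattice.TorusSectorPartitionFnTwoScaleTiling
import Literature.Computability.AlgebraicComplexity.SubspaceProjection
import HarnessLib
import HarnessLib.Audit

/-!
# Route `R2cOpenStripTangentLine` — the CRUXES (not only the leaf) from a seam-stack certificate:
# sector-pure / min-sector families, a zero-energy column annex, and the padded exact-filling all-`m` family

HONEST FRAMING: first certified bounds; not a superconductivity verdict; every number certified or labelled float.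
NO NUMBER IS CLAIMED HERE: every bound-valued theorem is an implication whose hypothesis is the sentence a
producer's certificate would assert (`proof.conditional` by design). Pen candidate (sr-mbsolver-var-7 g22), scratch;
a woken `hubbard-r2c-p1` / certfmt seat lands it under `Theorems/` if the crew wants the crux path.

The cruxes `RightFamilyBelowLine` / `LeftFamilyBelowLine` (stmt-Ventures-19262 / 19263) ask for an EXACT-NUMBER all-`k` family of
OPEN `a × (k·b)` clusters, `E_open(a × k·b; k·N) ≤ k·E + (k−1)·Δ`, at ONE finite width `a`, endpoint `(E+Δ)/(ab)` below the tangent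
line. A dressed seam-STACK certificate of `a = ∞` strips (FORMAT `bd-strip-seam-v1` §2 (L5), objects S3/S4 of crew (3)) prints, for
all `m, k ≥ 1`, a finite family `ψ_l` on the open `(k·c) × (m·W)` box, EACH `ψ_l` IN ONE NUMBER SECTOR of the window `k·m·Qc ± m·q₁`
(bottom boundary vector in one charge sector, top traced, number-preserving gates), `Σ‖ψ_l‖² = 1`, summed energy
`≤ k(m·cc + (m−1)σ) + m·β₁ + (m−1)·β₂`. Its MEAN-number reading closes the LEAF (tree `energyDensityTT'_le_of_stripStackFamily_all_rat`);
this file closes the CRUXES from the sector-pure (or the weaker min-sector) reading, with NO new producer computation: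
* § 1 `groundEnergy_hubbardOpenBoxTT'_appendCols_le` — PENALTY-FREE COLUMN CUT `E_open((a+r) × B; N₁+N₂) ≤ E_open(a × B; N₁) +
  E_open(r × B; N₂)` (tree `groundEnergy_twoGraph_le_add_of_induced` [Ruelle1969 §3.3] along `rectCastAdd` / `rectNatAdd`).
* § 2 `groundEnergy_hubbardOpenBoxTT'_le_zero_of_le_card` — ZERO-ENERGY ANNEX `E_open(r × B; M) ≤ 0` for `M ≤ r·B` (one spin-↑
  electron on each of `M` distinct sites; hopping is off-diagonal (`hamiltonian_apply_diag`), no double occupancy).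
* § 3 `allm_of_minSectorFamily` — MIN-SECTOR family at width `k₀·c` ⇒ EXACT-FILLING all-`m` family on the PADDED boxes
  `(k₀c + r) × mW` at `m·N` particles, `8N = 7(k₀c + r)W` (the annex absorbs the `m·N − M ∈ [0, m·r·W]` missing electrons at zero
  energy) = the crux's family shape with `a = k₀c + r`, `b = W`, `k = m`; § 4 both cruxes via the landed
  `bothFamiliesBelowLine_of_allk_sevenEighths`; § 5 the verbatim-certificate wrapper (all `k`, affine `B`, linear window; the node
  writer supplies `k₀, r, N` and five `norm_num` side conditions); § 6 the `W = 4` glide stack BY VALUE (`c = 16`, `Qc = 56`,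
  `r = 2q₁`, `N = 56k₀ + 7q₁`; bar `k₀·(cc+σ) + β₁ + β₂ ≤ −(1152/25)·k₀ − (144/25)·q₁`, solvable in `k₀` iff `cc + σ < −1152/25` STRICTLY).
* § 7 `exists_groundEnergy_le_of_sectorFamily` — MIN ≤ MEAN over a sector-pure family (`LiebThm1.groundEnergy_mul_norm_le`): some
  member with non-zero weight has `E_0(M_l) ≤ X`; § 8 both cruxes (+ leaf) from the SECTOR-PURE family = (L5) TYPED AS WORDED.
Leaf forms of § 4/§ 5 are one line each from `m3Upper_tp0_le_m18o25_of_families` and omitted.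

DISTANCE BY VALUE (forecasts FLOAT, labelled): bar per 64-site period `−1152/25 = −46.08`; S3 forecast `≈ −45.86` (short); S4 plaquette
forecast `≈ −46.2` [FLOAT-by-analogy, unmeasured at writing]; e.g. `cc + σ = −46.2`, `β₁ + β₂ = 60`, `q₁ = 4` (ILLUSTRATIVE) needs
`k₀ ≥ (60 + 23.04)/0.12 = 692` cell-columns — free, since the certificate's family is ∀ k.
-/

noncomputable section

open Matrix Finset
open scoped BigOperators ComplexOrder

namespace Summit.Ventures.CertifiedManyBodySolver.Theorems

open Literature.MathematicalPhysics.QuantumLattice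
open Literature.MathematicalPhysics.QuantumLattice.HubbardWave0
open Literature.MathematicalPhysics.QuantumLattice.ThermodynamicLimit
open Summit.Ventures.CertifiedManyBodySolver.Theses.R2cOpenStripTangentLine

/-! ## § 1 Penalty-free column cut of an open box -/

/-- Two decidability structures on the same adjacency give the same Hubbard Hamiltonian. [folklore] -/
private theorem hamiltonian_congr_dec {Λ : Type*} [LinearOrder Λ] [Fintype Λ] {G₁ G₂ : SimpleGraph Λ}
    [DecidableRel G₁.Adj] [DecidableRel G₂.Adj] (h : G₁ = G₂) (t U : ℝ) :
    hamiltonian G₁ t U = hamiltonian G₂ t U := by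
  subst h
  congr!

/-- **Penalty-free column cut.** For the OPEN `(a + r) × B` cluster of the `t–t′` Hubbard model and block particle numbers
`N₁ ≤ 2aB`, `N₂ ≤ 2rB`: `E_open((a+r) × B; N₁ + N₂) ≤ E_open(a × B; N₁) + E_open(r × B; N₂)` — the columns `[0, a)` and
`[a, a+r)` are an ordered cut of `Fin (a+r) ×ₗ Fin B`, the induced bond sets are the two open boxes, and the bonds joining
them have zero expectation in the graded product of sector vectors. [cite: Ruelle1969, §3.3] -/
theorem groundEnergy_hubbardOpenBoxTT'_appendCols_le (a r B : ℕ) (t t' U : ℝ) {N₁ N₂ : ℕ}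
    (hN₁ : N₁ ≤ 2 * (a * B)) (hN₂ : N₂ ≤ 2 * (r * B)) :
    groundEnergy (hubbardOpenBoxTT' (a + r) B t t' U) (N₁ + N₂) ≤
      groundEnergy (hubbardOpenBoxTT' a B t t' U) N₁ + groundEnergy (hubbardOpenBoxTT' r B t t' U) N₂ := by
  have hc₁ : N₁ ≤ 2 * Fintype.card (Fin a ×ₗ Fin B) := by rwa [card_rectSites]
  have hc₂ : N₂ ≤ 2 * Fintype.card (Fin r ×ₗ Fin B) := by rwa [card_rectSites]
  have h := groundEnergy_twoGraph_le_add_of_induced (rectBoxGraph (a + r) B) (rectBoxDiagGraph (a + r) B)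
    (strictMono_rectCastAdd a r B) (strictMono_rectNatAdd a r B) (rectCastAdd_lt_rectNatAdd a r B)
    (rectCastAdd_cover a r B) t U t' 0 hc₁ hc₂
  have e₁ : (rectBoxGraph (a + r) B).comap (rectCastAdd a r B) = rectBoxGraph a B :=
    comap_rectBoxGraph_eq_rectBoxGraph_of_offset _ 0 0 (fun p => by simp [rectCastAdd])
      (fun p => by simp [rectCastAdd])
  have e₁' : (rectBoxDiagGraph (a + r) B).comap (rectCastAdd a r B) = rectBoxDiagGraph a B :=
    comap_rectBoxDiagGraph_eq_rectBoxDiagGraph_of_offset _ 0 0 (fun p => by simp [rectCastAdd])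
      (fun p => by simp [rectCastAdd])
  have e₂ : (rectBoxGraph (a + r) B).comap (rectNatAdd a r B) = rectBoxGraph r B :=
    comap_rectBoxGraph_eq_rectBoxGraph_of_offset _ a 0 (fun p => by simp [rectNatAdd])
      (fun p => by simp [rectNatAdd])
  have e₂' : (rectBoxDiagGraph (a + r) B).comap (rectNatAdd a r B) = rectBoxDiagGraph r B :=
    comap_rectBoxDiagGraph_eq_rectBoxDiagGraph_of_offset _ a 0 (fun p => by simp [rectNatAdd])
      (fun p => by simp [rectNatAdd])
  rw [hamiltonian_congr_dec e₁, hamiltonian_congr_dec e₁', hamiltonian_congr_dec e₂,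
    hamiltonian_congr_dec e₂'] at h
  simpa only [hubbardOpenBoxTT'] using h

/-! ## § 2 The zero-energy annex -/

/-- **An occupation-basis vector of `M` spin-↑ electrons on distinct sites costs nothing.** For ANY two bond sets on a
finite ordered site set and `M ≤ |Λ|`: `E_{G,G'}(M) ≤ 0` — the configuration `s = S × {↑}` (`|S| = M`) is a unit
`M`-particle vector with `⟨s|H|s⟩ = (U + U')·#(doubly occupied sites of s) = 0` (the hopping is off-diagonal in the
occupation basis, `hamiltonian_apply_diag`). [cite: Ruelle1969, §3.3 (3.11)–(3.18)] -/
theorem groundEnergy_twoGraph_le_zero_of_le_card {Λ : Type*} [LinearOrder Λ] [Fintype Λ]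
    (G G' : SimpleGraph Λ) [DecidableRel G.Adj] [DecidableRel G'.Adj] (t U t' U' : ℝ) {M : ℕ}
    (hM : M ≤ Fintype.card Λ) :
    groundEnergy (hamiltonian G t U + hamiltonian G' t' U') M ≤ 0 := by
  classical
  obtain ⟨S, -, hS⟩ := Finset.exists_subset_card_eq (s := (Finset.univ : Finset Λ)) (n := M)
    (by rwa [Finset.card_univ])
  have hinj : Function.Injective (fun x : Λ => orb x 0) := fun x y h => (orb_inj.1 h).1
  set s : Finset (Orb Λ) := S.map ⟨fun x => orb x 0, hinj⟩ with hs_def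
  have hcard : s.card = M := by rw [hs_def, Finset.card_map, hS]
  have hN : IsNParticle M (Pi.single s (1 : ℂ) : Fock (Orb Λ)) := by
    intro u hu
    rw [Pi.single_apply, if_neg]
    rintro rfl
    exact hu hcard
  have h1 : star (Pi.single s (1 : ℂ) : Fock (Orb Λ)) ⬝ᵥ Pi.single s 1 = 1 := by
    rw [dotProduct_single, Pi.star_apply, Pi.single_eq_same, star_one, one_mul]
  have h := ThermodynamicLimit.groundEnergy_le_re_expect (hamiltonian G t U + hamiltonian G' t' U') hN h1
  have hd : doublyOccupied s = ∅ := by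
    ext x
    constructor
    · intro hx
      exfalso
      rw [mem_doublyOccupied] at hx
      obtain ⟨y, -, hy⟩ := Finset.mem_map.1 hx.2
      exact absurd (orb_inj.1 hy).2 (by decide)
    · intro hx
      simp at hx
  rw [Literature.MathematicalPhysics.QuantumLattice.expect,
    Literature.Computability.AlgebraicComplexity.star_single_dotProduct_mulVec_single, Matrix.add_apply,
    hamiltonian_apply_diag, hamiltonian_apply_diag, hd, Finset.card_empty] at h
  simpa using h

/-- **The zero-energy annex, open-box form.** `E_open(r × B; M) ≤ 0` for `M ≤ r·B` (any real `t, t', U`). [folklore] -/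
theorem groundEnergy_hubbardOpenBoxTT'_le_zero_of_le_card (r B : ℕ) (t t' U : ℝ) {M : ℕ} (hM : M ≤ r * B) :
    groundEnergy (hubbardOpenBoxTT' r B t t' U) M ≤ 0 := by
  have hc : M ≤ Fintype.card (Fin r ×ₗ Fin B) := by rwa [card_rectSites]
  simpa only [hubbardOpenBoxTT'] using
    groundEnergy_twoGraph_le_zero_of_le_card (rectBoxGraph r B) (rectBoxDiagGraph r B) t U t' 0 hc

/-! ## § 3 Min-sector family at one width ⇒ exact-filling all-`m` family on the padded boxes -/

/-- **Padding a min-sector family to exact filling.** Data: cell `c × W`, `Qc` electrons per cell, window half-width `q₁` per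
strip, width multiplier `k₀`, annex width `r`, padded per-strip number `N`, with the integer side conditions
`k₀·Qc + q₁ ≤ N` (the annex count `m·N − M` is never negative), `N + q₁ ≤ k₀·Qc + r·W` (it never exceeds the annex's `r·mW`
sites) and `k₀·Qc + q₁ ≤ 2·k₀·c·W` (the sub-box sector exists). Then a min-sector family on the boxes `k₀c × mW`,
`∀ m ≥ 1, ∃ M, m·k₀·Qc − m·q₁ ≤ M ≤ m·k₀·Qc + m·q₁, E_open(k₀c × mW; M) ≤ m·E₀ + (m−1)·Δ₀`, gives the exact-number family
`E_open((k₀c + r) × mW; m·N) ≤ m·E₀ + (m−1)·Δ₀` for every `m ≥ 1` (§ 1 column cut + § 2 zero-energy annex). [folklore] -/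
theorem allm_of_minSectorFamily (c W Qc q₁ k₀ r N : ℕ) (E₀ Δ₀ : ℚ)
    (hmin : k₀ * Qc + q₁ ≤ N) (hcap : N + q₁ ≤ k₀ * Qc + r * W) (hsub : k₀ * Qc + q₁ ≤ 2 * ((k₀ * c) * W))
    (hfam : ∀ m : ℕ, 1 ≤ m → ∃ M : ℕ, m * (k₀ * Qc) ≤ M + m * q₁ ∧ M ≤ m * (k₀ * Qc) + m * q₁ ∧
      groundEnergy (hubbardOpenBoxTT' (k₀ * c) (m * W) 1 0 8) M ≤ ((((m : ℚ) * E₀ + ((m : ℚ) - 1) * Δ₀) : ℚ) : ℝ)) :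
    ∀ m : ℕ, 1 ≤ m → groundEnergy (hubbardOpenBoxTT' (k₀ * c + r) (m * W) 1 0 8) (m * N) ≤
      ((((m : ℚ) * E₀ + ((m : ℚ) - 1) * Δ₀) : ℚ) : ℝ) := by
  intro m hm
  obtain ⟨M, hlo, hhi, hE⟩ := hfam m hm
  -- the four products as atoms
  have i₁ : m * (k₀ * Qc) + m * q₁ ≤ m * N := by
    have := Nat.mul_le_mul_left m hmin; simpa [Nat.mul_add] using this
  have i₂ : m * N + m * q₁ ≤ m * (k₀ * Qc) + m * (r * W) := by
    have := Nat.mul_le_mul_left m hcap; simpa [Nat.mul_add] using this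
  have i₃ : m * (k₀ * Qc) + m * q₁ ≤ m * (2 * ((k₀ * c) * W)) := by
    have := Nat.mul_le_mul_left m hsub; simpa [Nat.mul_add] using this
  have hMle : M ≤ m * N := hhi.trans i₁
  obtain ⟨N₂, hsplit⟩ : ∃ N₂ : ℕ, M + N₂ = m * N := ⟨m * N - M, Nat.add_sub_cancel' hMle⟩
  have hN₂ : N₂ ≤ r * (m * W) := by
    have e : r * (m * W) = m * (r * W) := by ring
    rw [e]
    generalize m * N = X at *
    generalize m * (k₀ * Qc) = Y at *
    generalize m * q₁ = Z at *
    generalize m * (r * W) = V at *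
    omega
  have hN₁ : M ≤ 2 * ((k₀ * c) * (m * W)) := by
    have e : 2 * ((k₀ * c) * (m * W)) = m * (2 * ((k₀ * c) * W)) := by ring
    rw [e]
    exact hhi.trans i₃
  have hN₂' : N₂ ≤ 2 * (r * (m * W)) := hN₂.trans (Nat.le_mul_of_pos_left _ (by norm_num))
  rw [← hsplit]
  calc groundEnergy (hubbardOpenBoxTT' (k₀ * c + r) (m * W) 1 0 8) (M + N₂)
      ≤ groundEnergy (hubbardOpenBoxTT' (k₀ * c) (m * W) 1 0 8) M +
          groundEnergy (hubbardOpenBoxTT' r (m * W) 1 0 8) N₂ :=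
        groundEnergy_hubbardOpenBoxTT'_appendCols_le (k₀ * c) r (m * W) 1 0 8 hN₁ hN₂'
    _ ≤ ((((m : ℚ) * E₀ + ((m : ℚ) - 1) * Δ₀) : ℚ) : ℝ) + 0 :=
        add_le_add hE (groundEnergy_hubbardOpenBoxTT'_le_zero_of_le_card r (m * W) 1 0 8 hN₂)
    _ = ((((m : ℚ) * E₀ + ((m : ℚ) - 1) * Δ₀) : ℚ) : ℝ) := add_zero _

/-! ## § 4 Both cruxes (and the leaf) from a min-sector family at filling `7/8` -/

/-- **Both cruxes from a min-sector seam-stack family.** With the data of `allm_of_minSectorFamily`, exact filling of the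
padded strip `8N = 7(k₀c + r)W`, `1 ≤ k₀c + r`, `1 ≤ W`, and the endpoint `(E₀ + Δ₀)/((k₀c + r)W) ≤ −18/25`, the min-sector
family witnesses `RightFamilyBelowLine ∧ LeftFamilyBelowLine` with `a = k₀c + r`, `b = W`, `k = m`
(`bothFamiliesBelowLine_of_allk_sevenEighths`). [folklore] -/
theorem bothFamiliesBelowLine_of_minSectorFamily_sevenEighths (c W Qc q₁ k₀ r N : ℕ) (E₀ Δ₀ : ℚ)
    (ha : 1 ≤ k₀ * c + r) (hW : 1 ≤ W) (hfill : 8 * N = 7 * ((k₀ * c + r) * W))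
    (hmin : k₀ * Qc + q₁ ≤ N) (hcap : N + q₁ ≤ k₀ * Qc + r * W) (hsub : k₀ * Qc + q₁ ≤ 2 * ((k₀ * c) * W))
    (hbar : (E₀ + Δ₀) / (((k₀ * c + r : ℕ) : ℚ) * (W : ℚ)) ≤ -18 / 25)
    (hfam : ∀ m : ℕ, 1 ≤ m → ∃ M : ℕ, m * (k₀ * Qc) ≤ M + m * q₁ ∧ M ≤ m * (k₀ * Qc) + m * q₁ ∧
      groundEnergy (hubbardOpenBoxTT' (k₀ * c) (m * W) 1 0 8) M ≤ ((((m : ℚ) * E₀ + ((m : ℚ) - 1) * Δ₀) : ℚ) : ℝ)) :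
    RightFamilyBelowLine ∧ LeftFamilyBelowLine :=
  bothFamiliesBelowLine_of_allk_sevenEighths (k₀ * c + r) W N E₀ Δ₀ ha hW hfill hbar
    (allm_of_minSectorFamily c W Qc q₁ k₀ r N E₀ Δ₀ hmin hcap hsub hfam)

/-! ## § 5 The verbatim-certificate wrapper: all `k`, affine `B m = m·β₁ + (m−1)·β₂`, linear window `q m = m·q₁` -/

/-- **Both cruxes from the certificate's ALL-`k` min-sector family.** The printed family (FORMAT `bd-strip-seam-v1` § 2 (L5),
min-sector wording): for all `m, k ≥ 1` some sector `M ∈ [k·m·Qc − m·q₁, k·m·Qc + m·q₁]` of the OPEN `(k·c) × (m·W)` cluster has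
`E_open ≤ k·(m·cc + (m−1)·σ) + m·β₁ + (m−1)·β₂`. The node writer chooses `k₀`, the annex width `r` and the padded number `N`
and checks the side conditions and the bar `k₀·(cc+σ) + β₁ + β₂ ≤ −(18/25)·(k₀c + r)·W` by `norm_num`; then
`E₀ := k₀·cc + β₁`, `Δ₀ := k₀·σ + β₂`. [folklore] -/
theorem bothFamiliesBelowLine_of_stripStackMinSectorFamily (c W Qc q₁ : ℕ) (cc σ β₁ β₂ : ℚ) (k₀ r N : ℕ)
    (hk₀ : 1 ≤ k₀) (ha : 1 ≤ k₀ * c + r) (hW : 1 ≤ W) (hfill : 8 * N = 7 * ((k₀ * c + r) * W))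
    (hmin : k₀ * Qc + q₁ ≤ N) (hcap : N + q₁ ≤ k₀ * Qc + r * W) (hsub : k₀ * Qc + q₁ ≤ 2 * ((k₀ * c) * W))
    (hbar : (k₀ : ℚ) * (cc + σ) + β₁ + β₂ ≤ -(18 / 25) * ((((k₀ * c + r : ℕ) : ℚ)) * (W : ℚ)))
    (hfam : ∀ m : ℕ, 1 ≤ m → ∀ k : ℕ, 1 ≤ k → ∃ M : ℕ,
      k * (m * Qc) ≤ M + m * q₁ ∧ M ≤ k * (m * Qc) + m * q₁ ∧
      groundEnergy (hubbardOpenBoxTT' (k * c) (m * W) 1 0 8) M ≤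
        ((((k : ℚ) * ((m : ℚ) * cc + ((m : ℚ) - 1) * σ) + (m : ℚ) * β₁ + ((m : ℚ) - 1) * β₂ : ℚ)) : ℝ)) :
    RightFamilyBelowLine ∧ LeftFamilyBelowLine := by
  have hpos : (0 : ℚ) < (((k₀ * c + r : ℕ) : ℚ)) * (W : ℚ) := by
    have h1 : (1 : ℚ) ≤ ((k₀ * c + r : ℕ) : ℚ) := by exact_mod_cast ha
    have h2 : (1 : ℚ) ≤ (W : ℚ) := by exact_mod_cast hW
    positivity
  refine bothFamiliesBelowLine_of_minSectorFamily_sevenEighths c W Qc q₁ k₀ r N ((k₀ : ℚ) * cc + β₁)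
    ((k₀ : ℚ) * σ + β₂) ha hW hfill hmin hcap hsub ?_ ?_
  · rw [div_le_iff₀ hpos]
    linarith
  · intro m hm
    obtain ⟨M, hlo, hhi, hE⟩ := hfam m hm k₀ hk₀
    refine ⟨M, by simpa [Nat.mul_left_comm] using hlo, by simpa [Nat.mul_left_comm] using hhi, hE.trans (le_of_eq ?_)⟩
    push_cast
    ring

/-! ## § 6 The `W = 4` glide stack by value: `c = 16`, `Qc = 56`, annex `r = 2q₁`, `N = 56k₀ + 7q₁` -/

/-- **Glide-stack instance.** For the `16 × 4` glide cell (`Qc = 56`, filling `7/8`) the annex `r = 2q₁` columns holds the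
`7q₁` padding electrons per strip at density exactly `7/8` (`8(56k₀ + 7q₁) = 7(16k₀ + 2q₁)·4`); the three integer side
conditions hold for every `k₀ ≥ 1` and `q₁ ≤ 72k₀` (the sub-box sector exists); the bar reads `k₀(cc+σ) + β₁ + β₂ ≤ −(1152/25)k₀ − (144/25)q₁`. [folklore] -/
theorem bothFamiliesBelowLine_of_glideW4MinSectorFamily (q₁ : ℕ) (cc σ β₁ β₂ : ℚ) (k₀ : ℕ) (hk₀ : 1 ≤ k₀)
    (hq₁ : q₁ ≤ 72 * k₀)
    (hbar : (k₀ : ℚ) * (cc + σ) + β₁ + β₂ ≤ -(1152 / 25) * (k₀ : ℚ) - (144 / 25) * (q₁ : ℚ))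
    (hfam : ∀ m : ℕ, 1 ≤ m → ∀ k : ℕ, 1 ≤ k → ∃ M : ℕ,
      k * (m * 56) ≤ M + m * q₁ ∧ M ≤ k * (m * 56) + m * q₁ ∧
      groundEnergy (hubbardOpenBoxTT' (k * 16) (m * 4) 1 0 8) M ≤
        ((((k : ℚ) * ((m : ℚ) * cc + ((m : ℚ) - 1) * σ) + (m : ℚ) * β₁ + ((m : ℚ) - 1) * β₂ : ℚ)) : ℝ)) :
    RightFamilyBelowLine ∧ LeftFamilyBelowLine := by
  refine bothFamiliesBelowLine_of_stripStackMinSectorFamily 16 4 56 q₁ cc σ β₁ β₂ k₀ (2 * q₁) (56 * k₀ + 7 * q₁)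
    hk₀ (by omega) (by norm_num) (by ring) (by omega) (by omega) (by omega) ?_ hfam
  have e : (((k₀ * 16 + 2 * q₁ : ℕ) : ℚ)) * ((4 : ℕ) : ℚ) = 64 * (k₀ : ℚ) + 8 * (q₁ : ℚ) := by push_cast; ring
  rw [e]
  linarith

/-- Leaf form of § 6. [folklore] -/
theorem m3Upper_tp0_le_m18o25_of_glideW4MinSectorFamily (q₁ : ℕ) (cc σ β₁ β₂ : ℚ) (k₀ : ℕ) (hk₀ : 1 ≤ k₀)
    (hq₁ : q₁ ≤ 72 * k₀)
    (hbar : (k₀ : ℚ) * (cc + σ) + β₁ + β₂ ≤ -(1152 / 25) * (k₀ : ℚ) - (144 / 25) * (q₁ : ℚ))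
    (hfam : ∀ m : ℕ, 1 ≤ m → ∀ k : ℕ, 1 ≤ k → ∃ M : ℕ,
      k * (m * 56) ≤ M + m * q₁ ∧ M ≤ k * (m * 56) + m * q₁ ∧
      groundEnergy (hubbardOpenBoxTT' (k * 16) (m * 4) 1 0 8) M ≤
        ((((k : ℚ) * ((m : ℚ) * cc + ((m : ℚ) - 1) * σ) + (m : ℚ) * β₁ + ((m : ℚ) - 1) * β₂ : ℚ)) : ℝ)) :
    MbsolverRungLeaves.M3Upper_tp0_le_m18o25 := by
  obtain ⟨hR, hL⟩ := bothFamiliesBelowLine_of_glideW4MinSectorFamily q₁ cc σ β₁ β₂ k₀ hk₀ hq₁ hbar hfam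
  exact m3Upper_tp0_le_m18o25_of_families hR hL

/-! ## § 7 A sector-pure mixture has a sector below its mean energy

FORMAT `bd-strip-seam-v1` § 2 (L5) AS WORDED: «bottom vector r of unit norm in ONE charge sector, top boundary traced ⇒ a finite family
ψ_l with Σ‖ψ_l‖² = 1 … dressed by the m − 1 gate layers (unitary: norms and per-strip particle numbers unchanged) … with particle number
in [k·m·Q_c − q_m, k·m·Q_c + q_m]» — i.e. EACH member `ψ_l` lies in ONE particle-number sector `M_l` of the window (U(1) cut labels),
the energy bound is on the SUM `Σ_l Re⟨ψ_l, H ψ_l⟩`. Typed faithfully («sector-pure family», § 8) this is STRONGER than both the tree's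
mean-number `hfam` and the min-sector family of § 3–§ 6, and § 7 extracts the min-sector statement from it: some member with
non-zero weight has `E_0(M_l) ≤ X` (homogeneous Rayleigh principle `LiebThm1.groundEnergy_mul_norm_le` + min ≤ weighted mean). -/

/-- **Min ≤ mean over a sector-pure family.** If `ψ_l` (`l < n`) are vectors with `ψ_l` in the `M_l`-particle sector,
`Σ_l ‖ψ_l‖² = 1` and `Σ_l Re⟨ψ_l, H ψ_l⟩ ≤ X`, then some `l` with `‖ψ_l‖² > 0` has `E_0^{(M_l)}(H) ≤ X`. [cite: Tasaki2020, §2.1] -/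
theorem exists_groundEnergy_le_of_sectorFamily {Λ : Type*} [LinearOrder Λ] [Fintype Λ]
    (H : Matrix (Finset (Orb Λ)) (Finset (Orb Λ)) ℂ) {n : ℕ} (ψ : Fin n → Fock (Orb Λ)) (Msec : Fin n → ℕ)
    (hsec : ∀ l, IsNParticle (Msec l) (ψ l)) (hS : ∑ l, (star (ψ l) ⬝ᵥ ψ l).re = 1) {X : ℝ}
    (hE : ∑ l, (star (ψ l) ⬝ᵥ (H *ᵥ ψ l)).re ≤ X) :
    ∃ l, 0 < (star (ψ l) ⬝ᵥ ψ l).re ∧ groundEnergy H (Msec l) ≤ X := by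
  by_contra hcon
  push Not at hcon
  have hw : ∀ l, 0 ≤ (star (ψ l) ⬝ᵥ ψ l).re := fun l =>
    (Complex.nonneg_iff.1 (dotProduct_star_self_nonneg (ψ l))).1
  -- every member: `X · ‖ψ_l‖² ≤ Re⟨ψ_l, H ψ_l⟩`, strictly where the weight is positive
  have hRay : ∀ l, groundEnergy H (Msec l) * (star (ψ l) ⬝ᵥ ψ l).re ≤ (star (ψ l) ⬝ᵥ (H *ᵥ ψ l)).re :=
    fun l => by simpa [Literature.MathematicalPhysics.QuantumLattice.expect] using
      LiebThm1.groundEnergy_mul_norm_le H (hsec l)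
  have hle : ∀ l ∈ (Finset.univ : Finset (Fin n)),
      X * (star (ψ l) ⬝ᵥ ψ l).re ≤ (star (ψ l) ⬝ᵥ (H *ᵥ ψ l)).re := by
    intro l _
    rcases (hw l).eq_or_lt with h0 | hpos
    · have h := hRay l
      rw [← h0, mul_zero] at h ⊢
      exact h
    · have h := hcon l hpos
      nlinarith [hRay l]
  -- some member has positive weight (the weights sum to 1)
  obtain ⟨l₀, -, hl₀⟩ : ∃ l ∈ (Finset.univ : Finset (Fin n)), 0 < (star (ψ l) ⬝ᵥ ψ l).re := by
    by_contra hnone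
    push Not at hnone
    have : ∑ l, (star (ψ l) ⬝ᵥ ψ l).re ≤ 0 := Finset.sum_nonpos hnone
    linarith
  have hlt : ∑ l, X * (star (ψ l) ⬝ᵥ ψ l).re < ∑ l, (star (ψ l) ⬝ᵥ (H *ᵥ ψ l)).re :=
    Finset.sum_lt_sum hle ⟨l₀, Finset.mem_univ _, by
      have h := hcon l₀ hl₀
      nlinarith [hRay l₀]⟩
  rw [← Finset.mul_sum, hS, mul_one] at hlt
  linarith

/-! ## § 8 Both cruxes from the SECTOR-PURE seam-stack family (FORMAT (L5) typed as worded) -/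

/-- **Both cruxes from the certificate's sector-pure all-`k` family.** For all `m, k ≥ 1` the printed family on the OPEN `(k·c) × (m·W)`
cluster consists of vectors `ψ_l`, EACH in one particle-number sector `M_l ∈ [k·m·Qc − m·q₁, k·m·Qc + m·q₁]`, with `Σ‖ψ_l‖² = 1` and
`Σ Re⟨ψ_l, H ψ_l⟩ ≤ k·(m·cc + (m−1)·σ) + m·β₁ + (m−1)·β₂`; then (§ 7) the min-sector family of § 5 holds and both cruxes follow with the
same side conditions. [folklore] -/
theorem bothFamiliesBelowLine_of_stripStackSectorFamily (c W Qc q₁ : ℕ) (cc σ β₁ β₂ : ℚ) (k₀ r N : ℕ)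
    (hk₀ : 1 ≤ k₀) (ha : 1 ≤ k₀ * c + r) (hW : 1 ≤ W) (hfill : 8 * N = 7 * ((k₀ * c + r) * W))
    (hmin : k₀ * Qc + q₁ ≤ N) (hcap : N + q₁ ≤ k₀ * Qc + r * W) (hsub : k₀ * Qc + q₁ ≤ 2 * ((k₀ * c) * W))
    (hbar : (k₀ : ℚ) * (cc + σ) + β₁ + β₂ ≤ -(18 / 25) * ((((k₀ * c + r : ℕ) : ℚ)) * (W : ℚ)))
    (hfam : ∀ m : ℕ, 1 ≤ m → ∀ k : ℕ, 1 ≤ k → ∃ n : ℕ, ∃ ψ : Fin n → Fock (Orb (Fin (k * c) ×ₗ Fin (m * W))),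
      ∃ Msec : Fin n → ℕ, (∀ l, IsNParticle (Msec l) (ψ l)) ∧
      (∀ l, k * (m * Qc) ≤ Msec l + m * q₁ ∧ Msec l ≤ k * (m * Qc) + m * q₁) ∧
      ∑ l, (star (ψ l) ⬝ᵥ ψ l).re = 1 ∧
      ∑ l, (star (ψ l) ⬝ᵥ (hubbardOpenBoxTT' (k * c) (m * W) 1 0 8 *ᵥ ψ l)).re ≤
        ((((k : ℚ) * ((m : ℚ) * cc + ((m : ℚ) - 1) * σ) + (m : ℚ) * β₁ + ((m : ℚ) - 1) * β₂ : ℚ)) : ℝ)) :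
    RightFamilyBelowLine ∧ LeftFamilyBelowLine := by
  refine bothFamiliesBelowLine_of_stripStackMinSectorFamily c W Qc q₁ cc σ β₁ β₂ k₀ r N hk₀ ha hW hfill hmin hcap hsub
    hbar ?_
  intro m hm k hk
  obtain ⟨n, ψ, Msec, hsec, hwin, hS, hE⟩ := hfam m hm k hk
  obtain ⟨l, -, hl⟩ := exists_groundEnergy_le_of_sectorFamily (hubbardOpenBoxTT' (k * c) (m * W) 1 0 8) ψ Msec
    hsec hS hE
  exact ⟨Msec l, (hwin l).1, (hwin l).2, hl⟩

/-- Leaf form of § 8 (generic cell). [folklore] -/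
theorem m3Upper_tp0_le_m18o25_of_stripStackSectorFamily (c W Qc q₁ : ℕ) (cc σ β₁ β₂ : ℚ) (k₀ r N : ℕ)
    (hk₀ : 1 ≤ k₀) (ha : 1 ≤ k₀ * c + r) (hW : 1 ≤ W) (hfill : 8 * N = 7 * ((k₀ * c + r) * W))
    (hmin : k₀ * Qc + q₁ ≤ N) (hcap : N + q₁ ≤ k₀ * Qc + r * W) (hsub : k₀ * Qc + q₁ ≤ 2 * ((k₀ * c) * W))
    (hbar : (k₀ : ℚ) * (cc + σ) + β₁ + β₂ ≤ -(18 / 25) * ((((k₀ * c + r : ℕ) : ℚ)) * (W : ℚ)))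
    (hfam : ∀ m : ℕ, 1 ≤ m → ∀ k : ℕ, 1 ≤ k → ∃ n : ℕ, ∃ ψ : Fin n → Fock (Orb (Fin (k * c) ×ₗ Fin (m * W))),
      ∃ Msec : Fin n → ℕ, (∀ l, IsNParticle (Msec l) (ψ l)) ∧
      (∀ l, k * (m * Qc) ≤ Msec l + m * q₁ ∧ Msec l ≤ k * (m * Qc) + m * q₁) ∧
      ∑ l, (star (ψ l) ⬝ᵥ ψ l).re = 1 ∧
      ∑ l, (star (ψ l) ⬝ᵥ (hubbardOpenBoxTT' (k * c) (m * W) 1 0 8 *ᵥ ψ l)).re ≤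
        ((((k : ℚ) * ((m : ℚ) * cc + ((m : ℚ) - 1) * σ) + (m : ℚ) * β₁ + ((m : ℚ) - 1) * β₂ : ℚ)) : ℝ)) :
    MbsolverRungLeaves.M3Upper_tp0_le_m18o25 := by
  obtain ⟨hR, hL⟩ := bothFamiliesBelowLine_of_stripStackSectorFamily c W Qc q₁ cc σ β₁ β₂ k₀ r N hk₀ ha hW hfill hmin
    hcap hsub hbar hfam
  exact m3Upper_tp0_le_m18o25_of_families hR hL

/-- **Glide-stack (`W = 4`, `c = 16`, `Qc = 56`) form of § 8.** [folklore] -/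
theorem bothFamiliesBelowLine_of_glideW4SectorFamily (q₁ : ℕ) (cc σ β₁ β₂ : ℚ) (k₀ : ℕ) (hk₀ : 1 ≤ k₀)
    (hq₁ : q₁ ≤ 72 * k₀)
    (hbar : (k₀ : ℚ) * (cc + σ) + β₁ + β₂ ≤ -(1152 / 25) * (k₀ : ℚ) - (144 / 25) * (q₁ : ℚ))
    (hfam : ∀ m : ℕ, 1 ≤ m → ∀ k : ℕ, 1 ≤ k → ∃ n : ℕ, ∃ ψ : Fin n → Fock (Orb (Fin (k * 16) ×ₗ Fin (m * 4))),
      ∃ Msec : Fin n → ℕ, (∀ l, IsNParticle (Msec l) (ψ l)) ∧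
      (∀ l, k * (m * 56) ≤ Msec l + m * q₁ ∧ Msec l ≤ k * (m * 56) + m * q₁) ∧
      ∑ l, (star (ψ l) ⬝ᵥ ψ l).re = 1 ∧
      ∑ l, (star (ψ l) ⬝ᵥ (hubbardOpenBoxTT' (k * 16) (m * 4) 1 0 8 *ᵥ ψ l)).re ≤
        ((((k : ℚ) * ((m : ℚ) * cc + ((m : ℚ) - 1) * σ) + (m : ℚ) * β₁ + ((m : ℚ) - 1) * β₂ : ℚ)) : ℝ)) :
    RightFamilyBelowLine ∧ LeftFamilyBelowLine := by
  refine bothFamiliesBelowLine_of_glideW4MinSectorFamily q₁ cc σ β₁ β₂ k₀ hk₀ hq₁ hbar ?_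
  intro m hm k hk
  obtain ⟨n, ψ, Msec, hsec, hwin, hS, hE⟩ := hfam m hm k hk
  obtain ⟨l, -, hl⟩ := exists_groundEnergy_le_of_sectorFamily (hubbardOpenBoxTT' (k * 16) (m * 4) 1 0 8) ψ Msec
    hsec hS hE
  exact ⟨Msec l, (hwin l).1, (hwin l).2, hl⟩

/-- Leaf form of the glide-stack sector family (through the route's own cruxes). [folklore] -/
theorem m3Upper_tp0_le_m18o25_of_glideW4SectorFamily (q₁ : ℕ) (cc σ β₁ β₂ : ℚ) (k₀ : ℕ) (hk₀ : 1 ≤ k₀)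
    (hq₁ : q₁ ≤ 72 * k₀)
    (hbar : (k₀ : ℚ) * (cc + σ) + β₁ + β₂ ≤ -(1152 / 25) * (k₀ : ℚ) - (144 / 25) * (q₁ : ℚ))
    (hfam : ∀ m : ℕ, 1 ≤ m → ∀ k : ℕ, 1 ≤ k → ∃ n : ℕ, ∃ ψ : Fin n → Fock (Orb (Fin (k * 16) ×ₗ Fin (m * 4))),
      ∃ Msec : Fin n → ℕ, (∀ l, IsNParticle (Msec l) (ψ l)) ∧
      (∀ l, k * (m * 56) ≤ Msec l + m * q₁ ∧ Msec l ≤ k * (m * 56) + m * q₁) ∧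
      ∑ l, (star (ψ l) ⬝ᵥ ψ l).re = 1 ∧
      ∑ l, (star (ψ l) ⬝ᵥ (hubbardOpenBoxTT' (k * 16) (m * 4) 1 0 8 *ᵥ ψ l)).re ≤
        ((((k : ℚ) * ((m : ℚ) * cc + ((m : ℚ) - 1) * σ) + (m : ℚ) * β₁ + ((m : ℚ) - 1) * β₂ : ℚ)) : ℝ)) :
    MbsolverRungLeaves.M3Upper_tp0_le_m18o25 := by
  obtain ⟨hR, hL⟩ := bothFamiliesBelowLine_of_glideW4SectorFamily q₁ cc σ β₁ β₂ k₀ hk₀ hq₁ hbar hfam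
  exact m3Upper_tp0_le_m18o25_of_families hR hL

end Summit.Ventures.CertifiedManyBodySolver.Theorems

end
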